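import Literature.MathematicalPhysics.KineticTheory.HardSphereBBGKYLiouvilleFlow
import Literature.Analysis.FluidPDE.HardSphereTorusMeasure
import Literature.Analysis.FluidPDE.BBGKYMarginalsProofs
import Mathlib.Analysis.SpecialFunctions.Exp
import HarnessLib

/-!
# Drifted Gaussian sums, velocity shifts, and a null set of tagged configurations

Sixth file of the proof of `Literature.MathematicalPhysics.KineticTheory.bbgky_hierarchy_of_liouville`
(**hilbert6.S07**; plan in `HardSphereBBGKYLiouvilleFlow`). The statement of the hierarchy only
constrains the boundary values of `F^{(s+1)}` through the collision operator, which reads them on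
a null set (approaching contact configurations, never good); the proof feeds the level-`s`
Duhamel identity with explicit boundary data solving the "divergence equation"
`bbgkyOp h = K` by a telescoping series along velocity shifts of one tagged particle
(`HardSphereBBGKYLiouvilleBoundary`). This file prepares that construction:

* §1 **Drifted Gaussian sums**: for `b > 0`, a real `x` and a step `ℓ ≥ 1`,
  `∑_{n<N} e^{-b (x + n ℓ)²} ≤ 2 ∑_k e^{-b k²}` uniformly in `x, ℓ, N` (the points `x + n ℓ` are
  `1`-separated, so `n ↦ ⌊|x + nℓ|⌋` is two-to-one at most); hence, for `u ∈ ℝ^d` with `‖u‖ ≥ 1`,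
  `∑_n e^{-b ‖v₀ + n u‖²} ≤ 2 ∑_k e^{-b k²}` (`‖w‖ ≥ |⟪w, u/‖u‖⟫|`).
* §2 **Velocity shifts** `S_u Y = update Y i₀ (x_{i₀}, v_{i₀} + u)` and the series
  `∑_n K(S_{n u} Y)` of a measurable `K` with `|K(Y)| ≤ A₀ e^{-b ‖v_{i₀}‖²}`: absolute convergence,
  the uniform bound `A₀ · 2∑_k e^{-bk²}` for `‖u‖ ≥ 1`, joint measurability in `(Y, u)`, and the
  **telescoping identity** `∑_n K(S_{nu}(S_u Y)) = ∑_n K(S_{nu} Y) - K(Y)`.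
* §3 **A null set of tagged configurations**: the configurations `Y` for which, for some
  `i ≠ i₀`, the set of directions `ω` with `dist(x_i + εω, x_{i₀}) = ε` has positive surface
  measure, form a Lebesgue-null measurable set (Tonelli and `Torus.volume_euclidDist_eq`). Off it,
  the collision terms of the pairs `(i, s+1)`, `i ≠ i₀`, do not see boundary data supported on
  contact configurations of the pair `(i₀, s+1)`.

Theorems only; no definition and no named fact is introduced.

## References

* C. Cercignani, R. Illner, M. Pulvirenti, *The Mathematical Theory of Dilute Gases*, Springer
  (1994), §4.3 (the collision operator `Q_{s+1}` reads `P^{(s+1)}` on `|x_i - x_{s+1}| = ε`).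
* I. Gallagher, L. Saint-Raymond, B. Texier, *From Newton to Boltzmann*, EMS (2013),
  arXiv:1208.5753, (4.3.5)–(4.3.6).
-/

open MeasureTheory Set Filter Topology Metric
open scoped ENNReal InnerProductSpace

namespace Literature.MathematicalPhysics.KineticTheory

open Literature.Analysis.FluidPDE

noncomputable section

/-! ## §1. Drifted Gaussian sums -/

section Drift

/-- `∑_k e^{-b k²}` converges for `b > 0` (comparison with the geometric series `e^{-b k}`). [folklore] -/
theorem summable_exp_neg_mul_natCast_sq {b : ℝ} (hb : 0 < b) :
    Summable fun k : ℕ => Real.exp (-b * (k : ℝ) ^ 2) := by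
  have hgeo : Summable fun k : ℕ => Real.exp ((k : ℝ) * (-b)) :=
    Real.summable_exp_nat_mul_iff.2 (by linarith)
  refine hgeo.of_nonneg_of_le (fun _ => (Real.exp_pos _).le) fun k => ?_
  apply Real.exp_le_exp.2
  have hk : (0 : ℝ) ≤ k := Nat.cast_nonneg k
  have hk2 : (k : ℝ) ≤ (k : ℝ) ^ 2 := by
    rcases Nat.eq_zero_or_pos k with h | h
    · simp [h]
    · have : (1 : ℝ) ≤ k := by exact_mod_cast h
      nlinarith
  nlinarith

/-- **Drifted Gaussian sums are uniformly bounded.** For `b > 0`, `ℓ ≥ 1` and any `x`,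
`∑_{n<N} e^{-b(x + nℓ)²} ≤ 2 ∑_k e^{-bk²}`: the points `y_n = x + nℓ` are `1`-separated, so on
each of the two half-lines `n ↦ ⌊|y_n|⌋` is injective, and `e^{-b y²} ≤ e^{-b ⌊|y|⌋²}`. [folklore] -/
theorem sum_range_exp_neg_mul_sq_le {b x ℓ : ℝ} (hb : 0 < b) (hℓ : 1 ≤ ℓ) (N : ℕ) :
    ∑ n ∈ Finset.range N, Real.exp (-b * (x + n * ℓ) ^ 2) ≤
      2 * ∑' k : ℕ, Real.exp (-b * (k : ℝ) ^ 2) := by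
  classical
  -- two nonnegative reals with the same integer part are less than `1` apart
  have hfloor : ∀ {a c : ℝ}, 0 ≤ a → 0 ≤ c → ⌊a⌋₊ = ⌊c⌋₊ → |a - c| < 1 := by
    intro a c ha hc h
    have h1 := Nat.floor_le ha
    have h2 := Nat.lt_floor_add_one a
    have h3 := Nat.floor_le hc
    have h4 := Nat.lt_floor_add_one c
    rw [h] at h1 h2
    rw [abs_lt]
    constructor <;> linarith
  set g : ℕ → ℝ := fun k => Real.exp (-b * (k : ℝ) ^ 2) with hg
  have hgs : Summable g := summable_exp_neg_mul_natCast_sq hb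
  have hg0 : ∀ k, 0 ≤ g k := fun k => (Real.exp_pos _).le
  -- pointwise: `e^{-b y²} ≤ g ⌊|y|⌋`
  have hpt : ∀ n : ℕ, Real.exp (-b * (x + n * ℓ) ^ 2) ≤ g ⌊|x + n * ℓ|⌋₊ := by
    intro n
    simp only [hg]
    apply Real.exp_le_exp.2
    have h1 : (⌊|x + n * ℓ|⌋₊ : ℝ) ≤ |x + n * ℓ| := Nat.floor_le (abs_nonneg _)
    have h2 : (⌊|x + n * ℓ|⌋₊ : ℝ) ^ 2 ≤ (x + n * ℓ) ^ 2 := by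
      rw [← sq_abs (x + n * ℓ)]
      exact pow_le_pow_left₀ (Nat.cast_nonneg _) h1 2
    nlinarith
  -- separation
  have hsep : ∀ n n' : ℕ, n ≠ n' → 1 ≤ |(x + n * ℓ) - (x + n' * ℓ)| := by
    intro n n' hne
    have : (x + n * ℓ) - (x + n' * ℓ) = ((n : ℝ) - n') * ℓ := by ring
    rw [this, abs_mul, abs_of_pos (show (0 : ℝ) < ℓ by linarith)]
    have h1 : (1 : ℝ) ≤ |(n : ℝ) - n'| := by
      rcases lt_or_gt_of_ne hne with h | h
      · have h' : (n : ℝ) + 1 ≤ n' := by exact_mod_cast h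
        rw [abs_of_nonpos (by linarith)]
        linarith
      · have h' : (n' : ℝ) + 1 ≤ n := by exact_mod_cast h
        rw [abs_of_nonneg (by linarith)]
        linarith
    exact one_le_mul_of_one_le_of_one_le h1 hℓ
  -- the two half-lines
  set P : Finset ℕ := (Finset.range N).filter fun n => 0 ≤ x + n * ℓ with hP
  set Q : Finset ℕ := (Finset.range N).filter fun n => ¬ 0 ≤ x + n * ℓ with hQ
  have hinjP : Set.InjOn (fun n : ℕ => ⌊|x + n * ℓ|⌋₊) P := by
    intro n hn n' hn' heq
    by_contra hne
    have hn0 : 0 ≤ x + n * ℓ := (Finset.mem_filter.1 hn).2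
    have hn0' : 0 ≤ x + n' * ℓ := (Finset.mem_filter.1 hn').2
    have hlt := hfloor (abs_nonneg (x + n * ℓ)) (abs_nonneg (x + n' * ℓ)) heq
    rw [abs_of_nonneg hn0, abs_of_nonneg hn0'] at hlt
    linarith [hsep n n' hne]
  have hinjQ : Set.InjOn (fun n : ℕ => ⌊|x + n * ℓ|⌋₊) Q := by
    intro n hn n' hn' heq
    by_contra hne
    have hn0 : x + n * ℓ < 0 := not_le.1 (Finset.mem_filter.1 hn).2
    have hn0' : x + n' * ℓ < 0 := not_le.1 (Finset.mem_filter.1 hn').2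
    have hlt := hfloor (abs_nonneg (x + n * ℓ)) (abs_nonneg (x + n' * ℓ)) heq
    rw [abs_of_neg hn0, abs_of_neg hn0'] at hlt
    have h' : |(x + n * ℓ) - (x + n' * ℓ)| < 1 := by
      rw [show (x + (n : ℝ) * ℓ) - (x + (n' : ℝ) * ℓ) = -(-(x + (n : ℝ) * ℓ) - -(x + (n' : ℝ) * ℓ)) by ring,
        abs_neg]
      exact hlt
    linarith [hsep n n' hne]
  have hsumP : ∑ n ∈ P, g ⌊|x + n * ℓ|⌋₊ ≤ ∑' k, g k := by
    rw [← Finset.sum_image hinjP]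
    exact hgs.sum_le_tsum _ fun k _ => hg0 k
  have hsumQ : ∑ n ∈ Q, g ⌊|x + n * ℓ|⌋₊ ≤ ∑' k, g k := by
    rw [← Finset.sum_image hinjQ]
    exact hgs.sum_le_tsum _ fun k _ => hg0 k
  calc ∑ n ∈ Finset.range N, Real.exp (-b * (x + n * ℓ) ^ 2)
      ≤ ∑ n ∈ Finset.range N, g ⌊|x + n * ℓ|⌋₊ := Finset.sum_le_sum fun n _ => hpt n
    _ = ∑ n ∈ P, g ⌊|x + n * ℓ|⌋₊ + ∑ n ∈ Q, g ⌊|x + n * ℓ|⌋₊ := by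
        rw [hP, hQ, ← Finset.sum_filter_add_sum_filter_not (Finset.range N) (fun n => 0 ≤ x + n * ℓ)]
    _ ≤ ∑' k, g k + ∑' k, g k := add_le_add hsumP hsumQ
    _ = 2 * ∑' k : ℕ, Real.exp (-b * (k : ℝ) ^ 2) := by rw [hg]; ring

variable {d : Type*} [Fintype d]

/-- A vector is at least as long as its component along a unit direction: for `u ≠ 0`,
`‖w‖ ‖u‖ ≥ |⟪w, u⟫|`, whence `‖v₀ + n u‖² ≥ (⟪v₀, u⟫/‖u‖ + n ‖u‖)²`. [folklore] -/
theorem sq_inner_div_add_le_norm_sq (v₀ u : EuclideanSpace ℝ d) (hu : u ≠ 0) (n : ℝ) :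
    (⟪v₀, u⟫_ℝ / ‖u‖ + n * ‖u‖) ^ 2 ≤ ‖v₀ + n • u‖ ^ 2 := by
  have hu0 : 0 < ‖u‖ := norm_pos_iff.2 hu
  have hcs : |⟪v₀ + n • u, u⟫_ℝ| ≤ ‖v₀ + n • u‖ * ‖u‖ := abs_real_inner_le_norm _ _
  have hinner : ⟪v₀ + n • u, u⟫_ℝ = ⟪v₀, u⟫_ℝ + n * ‖u‖ ^ 2 := by
    rw [inner_add_left, real_inner_smul_left, real_inner_self_eq_norm_sq]
  have hkey : ⟪v₀, u⟫_ℝ / ‖u‖ + n * ‖u‖ = ⟪v₀ + n • u, u⟫_ℝ / ‖u‖ := by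
    rw [hinner, eq_div_iff hu0.ne', add_mul, div_mul_cancel₀ _ hu0.ne']
    ring
  rw [hkey, div_pow]
  rw [div_le_iff₀ (by positivity)]
  calc ⟪v₀ + n • u, u⟫_ℝ ^ 2 = |⟪v₀ + n • u, u⟫_ℝ| ^ 2 := (sq_abs _).symm
    _ ≤ (‖v₀ + n • u‖ * ‖u‖) ^ 2 := pow_le_pow_left₀ (abs_nonneg _) hcs 2
    _ = ‖v₀ + n • u‖ ^ 2 * ‖u‖ ^ 2 := by ring

/-- **Drifted Gaussian sums in `ℝ^d`**: for `b > 0` and `‖u‖ ≥ 1`,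
`∑_{n<N} e^{-b‖v₀ + n u‖²} ≤ 2 ∑_k e^{-bk²}` uniformly in `v₀`, `u`, `N`. [folklore] -/
theorem sum_range_exp_neg_mul_norm_sq_le {b : ℝ} (hb : 0 < b) (v₀ u : EuclideanSpace ℝ d)
    (hu : 1 ≤ ‖u‖) (N : ℕ) :
    ∑ n ∈ Finset.range N, Real.exp (-b * ‖v₀ + (n : ℝ) • u‖ ^ 2) ≤
      2 * ∑' k : ℕ, Real.exp (-b * (k : ℝ) ^ 2) := by
  have hu0 : u ≠ 0 := by
    intro h; rw [h, norm_zero] at hu; linarith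
  refine le_trans (Finset.sum_le_sum fun n _ => ?_) (sum_range_exp_neg_mul_sq_le (x := ⟪v₀, u⟫_ℝ / ‖u‖) hb hu N)
  apply Real.exp_le_exp.2
  have := sq_inner_div_add_le_norm_sq v₀ u hu0 n
  nlinarith

/-- Summability and the uniform bound for the drifted Gaussian series in `ℝ^d` (`‖u‖ ≥ 1`). [folklore] -/
theorem summable_exp_neg_mul_norm_sq_drift {b : ℝ} (hb : 0 < b) (v₀ u : EuclideanSpace ℝ d)
    (hu : 1 ≤ ‖u‖) :
    Summable (fun n : ℕ => Real.exp (-b * ‖v₀ + (n : ℝ) • u‖ ^ 2)) ∧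
      ∑' n : ℕ, Real.exp (-b * ‖v₀ + (n : ℝ) • u‖ ^ 2) ≤ 2 * ∑' k : ℕ, Real.exp (-b * (k : ℝ) ^ 2) :=
  ⟨summable_of_sum_range_le (fun _ => (Real.exp_pos _).le) (sum_range_exp_neg_mul_norm_sq_le hb v₀ u hu),
    Real.tsum_le_of_sum_range_le (fun _ => (Real.exp_pos _).le) (sum_range_exp_neg_mul_norm_sq_le hb v₀ u hu)⟩

end Drift

/-! ## §2. Velocity shifts of one tagged particle and the telescoping series -/

section Shift

variable {d : Type*} [Fintype d] {X : Type*} {s : ℕ}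

omit [Fintype d] in
/-- Shifting the velocity of particle `i₀` by `0` does nothing. [folklore] -/
theorem update_vel_add_zero (Y : Config s d X) (i₀ : Fin s) :
    Function.update Y i₀ ((Y i₀).1, (Y i₀).2 + 0) = Y := by
  simp

omit [Fintype d] in
/-- Velocity shifts of particle `i₀` compose additively. [folklore] -/
theorem update_vel_add_update (Y : Config s d X) (i₀ : Fin s) (u w : EuclideanSpace ℝ d) :
    Function.update (Function.update Y i₀ ((Y i₀).1, (Y i₀).2 + u)) i₀
        (((Function.update Y i₀ ((Y i₀).1, (Y i₀).2 + u)) i₀).1,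
          ((Function.update Y i₀ ((Y i₀).1, (Y i₀).2 + u)) i₀).2 + w) =
      Function.update Y i₀ ((Y i₀).1, (Y i₀).2 + (u + w)) := by
  simp only [Function.update_self, Function.update_idem]
  congr 2
  abel

omit [Fintype d] in
/-- A velocity shift does not move the particles. [folklore] -/
theorem update_vel_apply_fst (Y : Config s d X) (i₀ : Fin s) (u : EuclideanSpace ℝ d) (k : Fin s) :
    ((Function.update Y i₀ ((Y i₀).1, (Y i₀).2 + u)) k).1 = (Y k).1 := by
  by_cases hk : k = i₀
  · subst hk; simp
  · simp [Function.update_of_ne hk]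

omit [Fintype d] in
/-- The shifted velocity. [folklore] -/
theorem update_vel_apply_snd_self (Y : Config s d X) (i₀ : Fin s) (u : EuclideanSpace ℝ d) :
    ((Function.update Y i₀ ((Y i₀).1, (Y i₀).2 + u)) i₀).2 = (Y i₀).2 + u := by
  simp

omit [Fintype d] in
/-- Other velocities are unchanged. [folklore] -/
theorem update_vel_apply_of_ne (Y : Config s d X) (i₀ : Fin s) (u : EuclideanSpace ℝ d) {k : Fin s}
    (hk : k ≠ i₀) : (Function.update Y i₀ ((Y i₀).1, (Y i₀).2 + u)) k = Y k := by
  simp [Function.update_of_ne hk]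

variable [MeasurableSpace X]

/-- The velocity shift `(Y, u) ↦ S_u Y` is jointly measurable. [folklore] -/
theorem measurable_update_vel (i₀ : Fin s) :
    Measurable fun p : Config s d X × EuclideanSpace ℝ d =>
      Function.update p.1 i₀ ((p.1 i₀).1, (p.1 i₀).2 + p.2) := by
  refine measurable_pi_lambda _ fun k => ?_
  by_cases hk : k = i₀
  · subst hk
    simp only [Function.update_self]
    exact ((measurable_pi_apply k).comp measurable_fst).fst.prodMk
      (((measurable_pi_apply k).comp measurable_fst).snd.add measurable_snd)
  · simp only [Function.update_of_ne hk]
    exact (measurable_pi_apply k).comp measurable_fst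

variable {A₀ b : ℝ} {i₀ : Fin s}

omit [MeasurableSpace X] in
/-- **The shifted series converges absolutely, with a uniform bound.** If
`|K(Y)| ≤ A₀ e^{-b‖v_{i₀}‖²}` (`b > 0`) then for `‖u‖ ≥ 1` the series `∑_n K(S_{nu} Y)` of the
values of `K` along the velocity shifts of particle `i₀` converges absolutely and
`∑_n |K(S_{nu} Y)| ≤ A₀ · 2∑_k e^{-bk²}` (`summable_exp_neg_mul_norm_sq_drift`). [folklore] -/
theorem summable_shift_series (hb : 0 < b) {K : Config s d X → ℝ}
    (hK : ∀ Y, |K Y| ≤ A₀ * Real.exp (-b * ‖(Y i₀).2‖ ^ 2)) (Y : Config s d X)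
    {u : EuclideanSpace ℝ d} (hu : 1 ≤ ‖u‖) :
    Summable (fun n : ℕ => K (Function.update Y i₀ ((Y i₀).1, (Y i₀).2 + (n : ℝ) • u))) ∧
      Summable (fun n : ℕ => |K (Function.update Y i₀ ((Y i₀).1, (Y i₀).2 + (n : ℝ) • u))|) ∧
      ∑' n : ℕ, |K (Function.update Y i₀ ((Y i₀).1, (Y i₀).2 + (n : ℝ) • u))| ≤
        A₀ * (2 * ∑' k : ℕ, Real.exp (-b * (k : ℝ) ^ 2)) := by
  have hA₀ : 0 ≤ A₀ := by
    have h := hK Y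
    have h2 : 0 < Real.exp (-b * ‖(Y i₀).2‖ ^ 2) := Real.exp_pos _
    nlinarith [abs_nonneg (K Y)]
  obtain ⟨hsum, hle⟩ := summable_exp_neg_mul_norm_sq_drift hb (Y i₀).2 u hu
  have hdom : ∀ n : ℕ, |K (Function.update Y i₀ ((Y i₀).1, (Y i₀).2 + (n : ℝ) • u))| ≤
      A₀ * Real.exp (-b * ‖(Y i₀).2 + (n : ℝ) • u‖ ^ 2) := by
    intro n
    have := hK (Function.update Y i₀ ((Y i₀).1, (Y i₀).2 + (n : ℝ) • u))
    rwa [update_vel_apply_snd_self] at this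
  have habs : Summable (fun n : ℕ => |K (Function.update Y i₀ ((Y i₀).1, (Y i₀).2 + (n : ℝ) • u))|) :=
    (hsum.mul_left A₀).of_nonneg_of_le (fun _ => abs_nonneg _) hdom
  refine ⟨habs.of_abs, habs, ?_⟩
  calc ∑' n : ℕ, |K (Function.update Y i₀ ((Y i₀).1, (Y i₀).2 + (n : ℝ) • u))|
      ≤ ∑' n : ℕ, A₀ * Real.exp (-b * ‖(Y i₀).2 + (n : ℝ) • u‖ ^ 2) :=
        habs.tsum_le_tsum hdom (hsum.mul_left A₀)
    _ = A₀ * ∑' n : ℕ, Real.exp (-b * ‖(Y i₀).2 + (n : ℝ) • u‖ ^ 2) := tsum_mul_left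
    _ ≤ A₀ * (2 * ∑' k : ℕ, Real.exp (-b * (k : ℝ) ^ 2)) := by gcongr

omit [MeasurableSpace X] in
/-- **Telescoping.** `∑_n K(S_{u + nu} Y) = ∑_n K(S_{nu} Y) - K(Y)` (shift of the summation
index, `Summable.tsum_eq_zero_add`); with `S_{nu} ∘ S_u = S_{u + nu}` (`update_vel_add_update`)
this is `∑_n K(S_{nu}(S_u Y)) = ∑_n K(S_{nu} Y) - K(Y)`. [folklore] -/
theorem tsum_shift_series_succ (hb : 0 < b) {K : Config s d X → ℝ}
    (hK : ∀ Y, |K Y| ≤ A₀ * Real.exp (-b * ‖(Y i₀).2‖ ^ 2)) (Y : Config s d X)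
    {u : EuclideanSpace ℝ d} (hu : 1 ≤ ‖u‖) :
    ∑' n : ℕ, K (Function.update Y i₀ ((Y i₀).1, (Y i₀).2 + (u + (n : ℝ) • u))) =
      ∑' n : ℕ, K (Function.update Y i₀ ((Y i₀).1, (Y i₀).2 + (n : ℝ) • u)) - K Y := by
  have hcomp : ∀ n : ℕ, u + (n : ℝ) • u = ((n + 1 : ℕ) : ℝ) • u := by
    intro n
    rw [Nat.cast_succ, add_smul, one_smul, add_comm]
  simp only [hcomp]
  obtain ⟨hs, -, -⟩ := summable_shift_series hb hK Y hu
  rw [hs.tsum_eq_zero_add]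
  simp only [Nat.cast_zero, zero_smul, add_zero]
  rw [show Function.update Y i₀ ((Y i₀).1, (Y i₀).2) = Y by simp]
  ring

/-- **Joint measurability of the shifted series** in `(Y, u)`: it is the pointwise limit of its
(measurable) partial sums wherever it converges, i.e. everywhere on `{‖u‖ ≥ 1}`; we state the
measurability of the series cut off to `1 ≤ ‖u‖` (the only region used). [folklore] -/
theorem measurable_tsum_shift_series (hb : 0 < b) {K : Config s d X → ℝ} (hKm : Measurable K)
    (hK : ∀ Y, |K Y| ≤ A₀ * Real.exp (-b * ‖(Y i₀).2‖ ^ 2)) :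
    Measurable fun p : Config s d X × EuclideanSpace ℝ d =>
      {q : Config s d X × EuclideanSpace ℝ d | 1 ≤ ‖q.2‖}.indicator
        (fun q => ∑' n : ℕ, K (Function.update q.1 i₀ ((q.1 i₀).1, (q.1 i₀).2 + (n : ℝ) • q.2))) p := by
  have hset : MeasurableSet {q : Config s d X × EuclideanSpace ℝ d | 1 ≤ ‖q.2‖} :=
    measurableSet_le measurable_const measurable_snd.norm
  -- partial sums are measurable
  have hterm : ∀ n : ℕ, Measurable fun q : Config s d X × EuclideanSpace ℝ d =>
      K (Function.update q.1 i₀ ((q.1 i₀).1, (q.1 i₀).2 + (n : ℝ) • q.2)) := by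
    intro n
    refine hKm.comp ?_
    refine measurable_pi_lambda _ fun k => ?_
    by_cases hk : k = i₀
    · subst hk
      simp only [Function.update_self]
      exact ((measurable_pi_apply k).comp measurable_fst).fst.prodMk
        (((measurable_pi_apply k).comp measurable_fst).snd.add (measurable_snd.const_smul (n : ℝ)))
    · simp only [Function.update_of_ne hk]
      exact (measurable_pi_apply k).comp measurable_fst
  have hpart : ∀ N : ℕ, Measurable fun q : Config s d X × EuclideanSpace ℝ d =>
      {q : Config s d X × EuclideanSpace ℝ d | 1 ≤ ‖q.2‖}.indicator
        (fun q => ∑ n ∈ Finset.range N, K (Function.update q.1 i₀ ((q.1 i₀).1, (q.1 i₀).2 + (n : ℝ) • q.2))) q :=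
    fun N => (Finset.measurable_sum _ fun n _ => hterm n).indicator hset
  refine measurable_of_tendsto_metrizable hpart ?_
  rw [tendsto_pi_nhds]
  intro q
  by_cases hq : q ∈ {q : Config s d X × EuclideanSpace ℝ d | 1 ≤ ‖q.2‖}
  · simp only [indicator_of_mem hq]
    obtain ⟨hs, -, -⟩ := summable_shift_series hb hK q.1 (u := q.2) hq
    exact hs.hasSum.tendsto_sum_nat
  · simp only [indicator_of_notMem hq]
    exact tendsto_const_nhds

end Shift

/-! ## §3. A null set of tagged configurations on the torus -/

section BadSet

variable {d : Type*} [Fintype d] {s : ℕ} {ε : ℝ}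

/-- For fixed `i ≠ i₀` and a fixed displacement `c`, the configurations with
`dist(x_i + c, x_{i₀}) = ε` form a Lebesgue-null set (`ε ≠ 0`; a minimal-image sphere condition
on `x_{i₀}`, `Torus.volume_euclidDist_eq`, one particle at a time). [folklore] -/
theorem volume_setOf_euclidDist_translate_eq (hε : ε ≠ 0) {i i₀ : Fin s} (hi : i ≠ i₀)
    (c : EuclideanSpace ℝ d) :
    volume {Y : Config s d (UnitAddTorus d) |
      Torus.euclidDist ((Torus.geometry d).translate (Y i).1 c) (Y i₀).1 = ε} = 0 := by
  have hmeas : MeasurableSet {Y : Config s d (UnitAddTorus d) |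
      Torus.euclidDist ((Torus.geometry d).translate (Y i).1 c) (Y i₀).1 = ε} := by
    have hc : Measurable fun Y : Config s d (UnitAddTorus d) =>
        Torus.euclidDist ((Torus.geometry d).translate (Y i).1 c) (Y i₀).1 := by
      have h1 : Measurable fun Y : Config s d (UnitAddTorus d) =>
          ((Torus.geometry d).translate (Y i).1 c, (Y i₀).1) := by
        simp only [Torus.geometry_translate]
        exact ((measurable_pi_apply i).fst.add_const _).prodMk (measurable_pi_apply i₀).fst
      have h2 := Torus.continuous_euclidDist.measurable.comp h1
      simpa only [Function.comp_def] using h2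
    exact measurableSet_eq_fun hc measurable_const
  refine volume_eq_zero_of_sections hmeas i₀ fun z => ?_
  have hsec : {y : UnitAddTorus d × EuclideanSpace ℝ d | Function.update z i₀ y ∈
      {Y : Config s d (UnitAddTorus d) |
        Torus.euclidDist ((Torus.geometry d).translate (Y i).1 c) (Y i₀).1 = ε}} =
      {x : UnitAddTorus d | Torus.euclidDist x ((Torus.geometry d).translate (z i).1 c) = ε} ×ˢ
        (univ : Set (EuclideanSpace ℝ d)) := by
    ext y
    simp only [mem_setOf_eq, Function.update_self, Function.update_of_ne hi, mem_prod, mem_univ,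
      and_true]
    rw [Torus.euclidDist_comm]
  rw [hsec, Measure.volume_eq_prod, Measure.prod_prod, Torus.volume_euclidDist_eq hε, zero_mul]

/-- Joint measurability of the cross-read indicator `(Y, ω) ↦ 1[dist(x_i + εω, x_{i₀}) = ε]`. [folklore] -/
theorem measurableSet_crossRead (ε : ℝ) (i i₀ : Fin s) :
    MeasurableSet {p : Config s d (UnitAddTorus d) × sphere (0 : EuclideanSpace ℝ d) 1 |
      Torus.euclidDist ((Torus.geometry d).translate (p.1 i).1 (ε • (p.2 : EuclideanSpace ℝ d))) (p.1 i₀).1 = ε} := by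
  have hc : Measurable fun p : Config s d (UnitAddTorus d) × sphere (0 : EuclideanSpace ℝ d) 1 =>
      Torus.euclidDist ((Torus.geometry d).translate (p.1 i).1 (ε • (p.2 : EuclideanSpace ℝ d))) (p.1 i₀).1 := by
    have hproj := (Literature.Analysis.FunctionSpaces.Torus.continuous_proj (d := d)).measurable
    have h1 : Measurable fun p : Config s d (UnitAddTorus d) × sphere (0 : EuclideanSpace ℝ d) 1 =>
        ((Torus.geometry d).translate (p.1 i).1 (ε • (p.2 : EuclideanSpace ℝ d)), (p.1 i₀).1) := by
      simp only [Torus.geometry_translate]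
      refine Measurable.prodMk ?_ ((measurable_pi_apply i₀).comp measurable_fst).fst
      exact ((measurable_pi_apply i).comp measurable_fst).fst.add
        (hproj.comp ((measurable_subtype_coe.comp measurable_snd).const_smul ε))
    have h2 := Torus.continuous_euclidDist.measurable.comp h1
    simpa only [Function.comp_def] using h2
  exact measurableSet_eq_fun hc measurable_const

/-- **The bad set of tagged configurations is null.** For `ε ≠ 0` and a tagged index `i₀`, the
set of `Y` such that for some `i ≠ i₀` the directions `ω` with `dist(x_i + εω, x_{i₀}) = ε`
have positive surface measure is a measurable Lebesgue-null set: by Tonelli its defining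
functions `Y ↦ σ{ω | …}` have integral `∫ vol{Y | …} dσ(ω) = 0`
(`volume_setOf_euclidDist_translate_eq`). [folklore] -/
theorem exists_badSet (hε : ε ≠ 0) (i₀ : Fin s) :
    MeasurableSet {Y : Config s d (UnitAddTorus d) | ∃ i : Fin s, i ≠ i₀ ∧
        sphereMeasure {ω : sphere (0 : EuclideanSpace ℝ d) 1 |
          Torus.euclidDist ((Torus.geometry d).translate (Y i).1 (ε • (ω : EuclideanSpace ℝ d))) (Y i₀).1 = ε} ≠ 0} ∧
      volume {Y : Config s d (UnitAddTorus d) | ∃ i : Fin s, i ≠ i₀ ∧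
        sphereMeasure {ω : sphere (0 : EuclideanSpace ℝ d) 1 |
          Torus.euclidDist ((Torus.geometry d).translate (Y i).1 (ε • (ω : EuclideanSpace ℝ d))) (Y i₀).1 = ε} ≠ 0} = 0 := by
  classical
  haveI : SFinite (sphereMeasure : Measure (sphere (0 : EuclideanSpace ℝ d) 1)) := by
    unfold sphereMeasure; infer_instance
  -- the defining functions
  have hf : ∀ i : Fin s, Measurable fun Y : Config s d (UnitAddTorus d) =>
      sphereMeasure {ω : sphere (0 : EuclideanSpace ℝ d) 1 |
        Torus.euclidDist ((Torus.geometry d).translate (Y i).1 (ε • (ω : EuclideanSpace ℝ d))) (Y i₀).1 = ε} := by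
    intro i
    have h := measurable_measure_prodMk_left (ν := (sphereMeasure : Measure (sphere (0 : EuclideanSpace ℝ d) 1)))
      (measurableSet_crossRead (d := d) (s := s) ε i i₀)
    exact h
  have hset_eq : {Y : Config s d (UnitAddTorus d) | ∃ i : Fin s, i ≠ i₀ ∧
      sphereMeasure {ω : sphere (0 : EuclideanSpace ℝ d) 1 |
        Torus.euclidDist ((Torus.geometry d).translate (Y i).1 (ε • (ω : EuclideanSpace ℝ d))) (Y i₀).1 = ε} ≠ 0} =
      ⋃ i ∈ (Finset.univ.filter fun i : Fin s => i ≠ i₀), {Y | sphereMeasure {ω : sphere (0 : EuclideanSpace ℝ d) 1 |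
        Torus.euclidDist ((Torus.geometry d).translate (Y i).1 (ε • (ω : EuclideanSpace ℝ d))) (Y i₀).1 = ε} ≠ 0} := by
    ext Y
    simp only [mem_setOf_eq, mem_iUnion, Finset.mem_filter, Finset.mem_univ, true_and, exists_prop]
  rw [hset_eq]
  refine ⟨Finset.measurableSet_biUnion _ fun i _ => (hf i) (measurableSet_singleton 0).compl, ?_⟩
  refine (measure_biUnion_null_iff (Finset.countable_toSet _)).2 fun i hi => ?_
  have hi' : i ≠ i₀ := (Finset.mem_filter.1 hi).2
  -- Tonelli: the integral of the defining function vanishes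
  haveI : SigmaFinite (volume : Measure (UnitAddTorus d × EuclideanSpace ℝ d)) := inferInstance
  haveI : SigmaFinite (volume : Measure (Config s d (UnitAddTorus d))) := inferInstance
  have hlin : ∫⁻ Y : Config s d (UnitAddTorus d), sphereMeasure {ω : sphere (0 : EuclideanSpace ℝ d) 1 |
      Torus.euclidDist ((Torus.geometry d).translate (Y i).1 (ε • (ω : EuclideanSpace ℝ d))) (Y i₀).1 = ε} = 0 := by
    have hS := measurableSet_crossRead (d := d) (s := s) ε i i₀
    have h1 := Measure.prod_apply (μ := (volume : Measure (Config s d (UnitAddTorus d))))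
      (ν := (sphereMeasure : Measure (sphere (0 : EuclideanSpace ℝ d) 1))) hS
    have h2 := Measure.prod_apply_symm (μ := (volume : Measure (Config s d (UnitAddTorus d))))
      (ν := (sphereMeasure : Measure (sphere (0 : EuclideanSpace ℝ d) 1))) hS
    have h3 : ∀ ω : sphere (0 : EuclideanSpace ℝ d) 1,
        (volume : Measure (Config s d (UnitAddTorus d))) ((fun Y : Config s d (UnitAddTorus d) => (Y, ω)) ⁻¹'
          {p : Config s d (UnitAddTorus d) × sphere (0 : EuclideanSpace ℝ d) 1 |
            Torus.euclidDist ((Torus.geometry d).translate (p.1 i).1 (ε • (p.2 : EuclideanSpace ℝ d))) (p.1 i₀).1 = ε}) = 0 := by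
      intro ω
      have h4 := volume_setOf_euclidDist_translate_eq (d := d) hε hi' (ε • (ω : EuclideanSpace ℝ d))
      simp only [Set.preimage_setOf_eq]
      exact h4
    simp only [h3, lintegral_zero] at h2
    rw [h2] at h1
    exact h1.symm
  have hae := (lintegral_eq_zero_iff (hf i)).1 hlin
  rw [Filter.EventuallyEq, ae_iff] at hae
  simpa using hae

end BadSet

end

end Literature.MathematicalPhysics.KineticTheory
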